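import Summits.ResolutionOfSingularities.ResolutionOfSingularities.Theorems.FloorCutFloor
import HarnessLib

/-!
# FloorCut — node «FloorCut» (decomp-res · lens-3 «one certified EQUIV + split beneath» · generation 14)
[WRITER NOTE (decomp-res writer g5): tree file 2/3 = the node record (this lens header, VERBATIM) + §3 THE NEW PIECES
(`ShadeNeverIncreases`, `NoFloorEdgePlateauxDeep`, `NoHighPlateauxDeep`, `NoHighPlateauxDeepTwo`,
`NoFloorTailsDeep`) + §5 LAWS OF THE
HIGH REGIME (PROVED) incl. `high_iff_highTwo`, `NoHighPlateauxDeepOne` / `noHighPlateauxDeepOne_holds`, the high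
windows — cone-free.
The lens's §3 RESTATED pieces are the tree's and are NOT restated here: `NoRecurrentSubcriticalPlateauxDeep` =
`JumpCut.NoRecurrentSubcriticalPlateauxDeep` (Theorems/JumpCutPlateaux), `NoOriginTails` = `ProximityCut.NoOriginTails` (PROVED:
`ProximityCut.noOriginTails_holds`); everything that mentions them (§4 the exact cut + necessity, §6 wiring, §6b
discharge) is in
`MaxContactCutFloorCut`.  `ShadeNeverIncreases` stays a named hypothesis here and is DISCHARGED there by
`NoJump.shade_succ_le_shade`.]

Host route `MaxContactCut`; blocker aside **31770** `MaxContactCut.DefectWalksDeep`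
(`= TightDefectClasses.DefectWalksTerminateDeep`).  After g13 (JumpCut ∥ lens-5 g14 NoJump: no forced walk ever jumps,
31871 PROVED) the ONE located residual of the E-format deep column was the HOME statement
`JumpCut.NoRecurrentSubcriticalPlateauxDeep` («no infinite forced deep walk whose shade is eventually a constant
`s ∈ [1, q−1]` and which makes translated moves at infinitely many times»), `≡ 31770` modulo the DECIDED pieces
`NoOriginTails` (lens-3 g12) and `NoCriticalFreePlateauxDeep` (tree, g11: bare = port, loaded = desk-decided g12).

## The g14 cut: the ORDER FLOOR `o_t = q`
Along a forced walk `q ≤ o_t < 2q` (light landing).  On a plateau of height `s` the boundary mass is `m_t = o_t − s` and the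
ledger reads `m_{t+1} = |kept_t| + (o_t − q)`.

* **FLOOR ABSORPTION (PROVED, §2).**  If `o_{t₀} = q` at some time of the plateau then for ALL `t ≥ t₀`:
  `o_t = q`, `kept_t = r_t` and `r_t = r_{t₀}` — the boundary is FROZEN; every positive component is kept at every step
  (the chart is never a positive component, the point lies on every positive component).  With two positive components the
  point is the origin for ever (no translations); so a translation-recurrent floor plateau drags exactly ONE component:
  `r_t = (q − s)·e_i`, charts `j_t ≠ i`, `b_t i = 0` — the walk HUGS the exceptional plane `E_i` for ever (§2
  `floor_single`).
* **EXACT SPLIT OF THE PARENT (PROVED, §4):**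
  `NoRecurrentSubcriticalPlateauxDeep ⟺ NoFloorEdgePlateauxDeep ∧ NoHighPlateauxDeep`
  (floor: `o_t = q` from some time on, one frozen hugged edge; high: `o_t > q` for all large `t`).
* **THE FLOOR IS KNOWN-MOD-PORT (§3 `NoFloorTailsDeep` = the tree's bare cell `NoBareTailsDeep` with the clause
  `r_t = 0` deleted).**  At a floor time the hypersurface `X_t = V(Z^q + F_t) ⊂ 𝔸⁴` has `ord F_t = q`, `F_t` cleaned,
  hence tangent cone `Z^q + Φ_t` with `Φ_t = in_q F_t ≠ 0` not a `q`-th power of a linear form: `e_{x_t}(X_t) ≤ 1`,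
  and the tail is the FUNDAMENTAL SEQUENCE of CJS2020 Def. 5.34 at the isolated point `x_{t₀}` with `B := ∅` — finite
  by CJS2020 Cor. 5.37 / Thm. 5.35 (X of ARBITRARY dimension, loc. cit. p. 9; verbatim for `p ≥ 3` by (F1)
  `p ≥ dim X/2 + 1`, rider `p = 2` by K-rationality of the centres over the perfect field `K`) — LITERALLY the port
  `BareTailPort` by which g11 booked the bare critical cell, read boundary-free: the model's `F`-dynamics
  (`step.F = deletePthPowers q (pointTransform q j b s)`) never sees the bookkeeping `r`.  `NoFloorTailsDeep` is
  WEAKER than 31770 by letter and implies `NoBareTailsDeep` (§4).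
* **THE HIGH HALF IS THE LOCATED RESIDUAL (§3 `NoHighPlateauxDeepTwo`)** = the `e_x = 3` regime (tangent cone
  `Z^q`) on a subcritical plateau with translations i.o.  PROVED laws (§5): height `s = 1` is DECIDED (no translated
  step is possible: `noHighPlateaux_shade_one`; booked as the NAMED CLASS `NoHighPlateauxDeepOne` with
  `noHighPlateauxDeepOne_holds`, and `high_iff_one_two : High ↔ HighOne ∧ HighTwo`); after every translated step
the boundary has
  `≤ 2` components and mass `≤ q − 1` (`translated_step_light`); a free step needs mass `≥ 2q − 2s + 1`
  (`high_free_step`); windows `q < o_t < 2q`, `q + 1 ≤ s + m_t ≤ 2q − 1`.  So the residual lives at `2 ≤ s ≤ q − 1`.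
* **THE ONE CERTIFIED EQUIV (§6 `defectDeep_iff_pieces`), modulo the two PROVED HOME theorems restated in §3
  (`ShadeNeverIncreases` = lens-5 g14 / lens-3 g13 no-jump law; `NoOriginTails` = lens-3 g12):**
  `DefectWalksTerminateDeep ⟺ NoLoadedCriticalPlateauxDeep ∧ NoFloorTailsDeep ∧ NoHighPlateauxDeepTwo`
  — loaded critical cell (tree; desk-decided g12) ∧ FLOOR cell (port) ∧ THE residual.  Asides BY NAME:
  `icNoPlateauDeep_of_pieces (hO) (hL) (hT) (hH) : MaxContactCut.ICNoPlateauDeep` (31870) and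
  `defectWalksDeep_of_pieces (hJ : MaxContactCut.ICNoRecurrentJumpDeep) (hO) (hL) (hT) (hH) :
  MaxContactCut.DefectWalksDeep` (31770; `hJ` = 31871, PROVED in HOME); `defectWalksDeep_iff_high`: 31770 ⟺ THE
  residual modulo the decided / ported pieces.  `closes` (§7) is the route's deciding theorem BY NAME.

All theorems here are PROVED (0 sorry) from TREE facts only (`BoundaryLedgerModel/Classes`, `ItineraryCutClasses`,
`TightDefectStrongWalks`); nothing is imported from HOME files.  Restated HOME statements (§3:
`NoRecurrentSubcriticalPlateauxDeep`,
`NoOriginTails`) are BYTE-IDENTICAL to lens-3 g13 `JumpCut.lean` rev 2 (sha256 0a503d38…; `NoOriginTails` = g12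
`ProximityCut.lean` :1715); `ShadeNeverIncreases` is the Prop form of the HOME theorems `shade_succ_le_shade` (lens-5 g14
`NoJump.lean`, lens-3 g13 `JumpCut.lean`).

Sources: Hauser2010 §§D,F,G; HauserPerlega2019; CJS2020 (doi:10.1007/978-3-030-52640-5) Def. 5.34, Thm. 5.35, Cor. 5.37,
Thm. 2.14, §9; CossartPiltant2019; Moh1987; BenitoVillamayor2013 §7.
-/

open MvPolynomial Finset
open Literature.AlgebraicGeometry.Resolution
open Literature.AlgebraicGeometry.Resolution.Hauser2010
open Literature.AlgebraicGeometry.Resolution.PointBlowup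
open Summit.ResolutionOfSingularities.ResolutionOfSingularities.Theorems.TightDefectClasses
open Summit.ResolutionOfSingularities.ResolutionOfSingularities.Theorems.TightDefectStrongWalks
open Summit.ResolutionOfSingularities.ResolutionOfSingularities.Theorems.ItineraryCutClasses
open Summit.ResolutionOfSingularities.ResolutionOfSingularities.Theorems.BoundaryLedger

namespace Summit.ResolutionOfSingularities.ResolutionOfSingularities.Theorems.FloorCut

/-! ## §3 THE PIECES (the NEW classes; the parent `JumpCut.NoRecurrentSubcriticalPlateauxDeep` and
`ProximityCut.NoOriginTails` are the tree's) -/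

/-- **`ShadeNeverIncreases`** — the NO-JUMP LAW as a named statement: along a forced walk from a root (`q = pᵉ`,
`e ≥ 1`) the shade never increases.  PROVED twice in HOME (lens-5 g14 `NoJump.shade_succ_le_shade`, lens-3 g13
`JumpCut.shade_succ_le_shade`; tree landing pending); used here only as a named hypothesis for the necessity
directions and for the jump half. [DECIDED (lens-5 g14 / lens-3 g13) · hypothesis here] -/
def ShadeNeverIncreases : Prop :=
  ∀ p : ℕ, p.Prime → ∀ e : ℕ, 1 ≤ e → ∀ (K : Type) [Field K] [CharP K p] [PerfectField K] [DecidableEq K]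
    (s₀ : State (Fin 3) K), IsRoot (p ^ e) s₀ → ∀ W : ForcedWalk (p ^ e) s₀,
    ∀ t : ℕ, (W.st (t + 1)).shade ≤ (W.st t).shade

/-- **`NoFloorEdgePlateauxDeep` — the FLOOR half of the parent (NEW).**  No infinite forced deep walk which, from some
time on, sits on a plateau of height `s ∈ [1, q−1]` AT THE ORDER FLOOR `o_t = q` with boundary the single frozen
edge `r_t = (q − s)·e_i`, hugging `E_i` (`j_t ≠ i`, `b_t i = 0`), and makes translated moves at infinitely many
times.  By FLOOR ABSORPTION (§2) this is exactly what a floor time on a translation-recurrent subcritical plateau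
produces.  Geometrically the hypersurface `Z^q + F_t` has `ord F_t = q` with `F_t` cleaned ⇒ `e_x ≤ 1`, and the tail
is CJS's fundamental sequence at an isolated point — the port text of `NoFloorTailsDeep`.
[KNOWN-MOD-PORT `BareTailPort` · WEAKER than the parent (`floorEdge_of_recSubcritical`) · INSTRUMENTABLE T-plateau
(floor-edge bed)]  (Sources: CJS2020 Def. 5.34, Thm. 5.35, Cor. 5.37; Hauser2010 §G.) -/
def NoFloorEdgePlateauxDeep : Prop :=
  ∀ p : ℕ, p.Prime → ∀ e : ℕ, 2 ≤ e → ∀ (K : Type) [Field K] [CharP K p] [PerfectField K] [DecidableEq K]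
    (s₀ : State (Fin 3) K), IsRoot (p ^ e) s₀ → ∀ W : ForcedWalk (p ^ e) s₀,
    ∀ N s : ℕ, ∀ i : Fin 3, 1 ≤ s → s < p ^ e →
    (∀ t, N ≤ t → (W.st t).shade = (s : ℕ∞) ∧ ordZero (W.st t).F = ((p ^ e : ℕ) : ℕ∞) ∧
      (W.st t).r = Finsupp.single i (p ^ e - s) ∧ W.j t ≠ i ∧ W.b t i = 0) →
    (∀ M : ℕ, ∃ i, M ≤ i ∧ W.b i ≠ 0) → False

/-- **`NoHighPlateauxDeep` — the HIGH half of the parent = THE LOCATED RESIDUAL after this node (NEW).**  No infinite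
forced deep walk which, from some time on, sits on a plateau of height `s ∈ [1, q−1]` STRICTLY ABOVE the order floor
(`o_t > q` for all large `t`: tangent cone `Z^q`, `e_x = 3`, outside CJS's `e ≤ 2` theory) and makes translated moves
at infinitely many times.  PROVED laws (§5): `s = 1` is impossible (`noHighPlateaux_shade_one`), so the residual
lives at `2 ≤ s ≤ q − 1` (`high_iff_highTwo`); after every translated step the boundary has `≤ 2` components and
mass `≤ q − 1` (`translated_step_light`); a free step needs mass `≥ 2q − 2s + 1` before it (`high_free_step`);
windows `q < o_t < 2q`, `q − s + 1 ≤ m_t ≤ 2q − s − 1`.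
[UNDECIDED · WEAKER than the parent (`high_of_recSubcritical`) · IDEA-NEEDED · INSTRUMENTABLE T-plateau (high bed:
per (p,q,s) the translated-step census, component counts, Frobenius lifts at degree q, and whether `p ∣ s`)]
(Sources: Hauser2010 §§F,G; HauserPerlega2019; CJS2020 §5.3; BenitoVillamayor2013 §7.) -/
def NoHighPlateauxDeep : Prop :=
  ∀ p : ℕ, p.Prime → ∀ e : ℕ, 2 ≤ e → ∀ (K : Type) [Field K] [CharP K p] [PerfectField K] [DecidableEq K]
    (s₀ : State (Fin 3) K), IsRoot (p ^ e) s₀ → ∀ W : ForcedWalk (p ^ e) s₀,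
    ∀ N s : ℕ, 1 ≤ s → s < p ^ e →
    (∀ t, N ≤ t → (W.st t).shade = (s : ℕ∞) ∧ ((p ^ e : ℕ) : ℕ∞) < ordZero (W.st t).F) →
    (∀ M : ℕ, ∃ i, M ≤ i ∧ W.b i ≠ 0) → False

/-- **`NoHighPlateauxDeepTwo`** — the same at heights `2 ≤ s`: EXACTLY equivalent (`high_iff_highTwo`; height 1 is
decided by the ledger).  THE FORM IN WHICH THE RESIDUAL IS BOOKED. [UNDECIDED · ≡ `NoHighPlateauxDeep`] -/
def NoHighPlateauxDeepTwo : Prop :=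
  ∀ p : ℕ, p.Prime → ∀ e : ℕ, 2 ≤ e → ∀ (K : Type) [Field K] [CharP K p] [PerfectField K] [DecidableEq K]
    (s₀ : State (Fin 3) K), IsRoot (p ^ e) s₀ → ∀ W : ForcedWalk (p ^ e) s₀,
    ∀ N s : ℕ, 2 ≤ s → s < p ^ e →
    (∀ t, N ≤ t → (W.st t).shade = (s : ℕ∞) ∧ ((p ^ e : ℕ) : ℕ∞) < ordZero (W.st t).F) →
    (∀ M : ℕ, ∃ i, M ≤ i ∧ W.b i ≠ 0) → False

/-- **`NoFloorTailsDeep` — the FLOOR CELL in tree shape = the tree's bare cell `NoBareTailsDeep` with the clause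
`r_t = 0` DELETED (NEW; the PORT CONCLUSION, typed IN MODEL TERMS, ANY boundary `r`).**  No infinite forced deep walk
with positive shade has order EXACTLY `q` from some time on.
PORT `BareTailPort` READ BOUNDARY-FREE (the hypersurface ignores `r`: `step.F = deletePthPowers q (pointTransform q j b s)`
never reads `s.r`).  Dictionary to the tree's print-faithful NAMED FACT
`Literature.AlgebraicGeometry.Resolution.CJS2020_noInfiniteNearChain_eOne` (CJS2020 Thm. 6.35 / Cor. 6.37 book
numbering = arXiv Thm. 5.35 / Cor. 5.37; `NearChainTerminationEOne.lean` :70) with `N = 3`, `R = K[Z,y₁,y₂,y₃]`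
(excellent regular), `J_0 = (Z^q + F_N)` principal of order `μ = q` at the origin `x_N` (embedding dimension `N + 1 = 4`),
`π_n` = the point blow-ups, `J_{n+1}` = controlled transform with control `q` (= the model's `y_j^{-q}·F(chart)`; the
cleaning `Z ↦ Z + c^{1/q}y^d`, `K` perfect, changes the regular parameter `Z`, not the ideal), `y_n = x_{n+1}` near
(`W.equimult`):  (i) ISOLATION CLAUSE: `W.isolated N : IsolatedTop q F_N` says the origin is isolated in `V(J_{F_N})`,
and `V(J_F)` is the projection to `y`-space of the multiplicity-`q` locus of `Z^q + F` (tree `topIdeal`, `r`-free) —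
this is the fact's prime-ideal clause «no non-maximal `𝔮` with `J_0 𝒪_𝔮 ⊆ 𝔮^q 𝒪_𝔮`».  (ii) `τ
= 3` (`e = 1` EXACTLY) AT
EVERY FLOOR STAGE `t ≥ N`, char-free: an equimultiple point `b` in chart `j` (`W.equimult t`) forces
`in_q F_t = c·y_j^q + h_q((y_i − b_i y_j)_{i ≠ j})` (dehomogenise at `y_j = 1`: `Φ(ŷ + b̂) −` const has no monomial of
degree `1 … q−1` and degree `≤ q`), so `Z^q + in_q F_t = (Z + c^{1/q} y_j)^q + h_q(ℓ₁, ℓ₂) ∈ K[Z′,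
ℓ₁, ℓ₂]`: `τ ≤ 3`;
and `τ ≤ 2` would make `in_q F_t = λ₁^q + g·λ₂^q` a sum of `q`-th power monomials (Frobenius on linear forms,
`C(q,k) = 0` for `0 < k < q`), i.e. killed by the cleaning `walk_clean` — contradiction; so `stalkTau = 3 = N` at `x_t`
and (floor absorption keeps `o_{t+1} = q`) at `y_t = x_{t+1}`, and the next centre IS the directrix point `P(Dir) =
{[b]}`.  (iii) CHARACTERISTIC: the fact's range `N + 2 ≤ 2p ⇔ p ≥ 3` ((F1) `p ≥ dim X/2 + 1`).
SCOPE TAG: [KNOWN-MOD-PORT `BareTailPort` = DECIDED-MOD-PORT (p ≥ 3, by `CJS2020_noInfiniteNearChain_eOne` + this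
dictionary) · p = 2 RIDER (M-level: the centres are `K`-rational over the perfect field `K`, so `B_{P,x′}` is a `K`-line
and Thm. 2.14's «near points lie on `P(Dir_x)`» — the use of (F1) in the proof of Thm. 9.2/10.2 — holds; = the rider
accepted for the bare cell, critic row 73, LOW risk; NOTE the census beds `(p,q) = (2,4), (2,8)` are ALL in the rider's
regime `p = 2`) · WEAKER than 31770 by letter (`floorTails_of_deep`) · implies `NoBareTailsDeep` (`bare_of_floorTails`:
the g11 port becomes the `r = 0` corollary) and `NoFloorEdgePlateauxDeep` (`floorEdge_of_floorTails`, via the PROVED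
no-jump law)]  (Sources: CJS2020 Def. 5.34, Thm. 5.35, Rem. 5.36, Cor. 5.37, Thm. 2.14, Thm. 3.14, Thm. 9.2;
CossartPiltant2019; Hauser2010 §G.) -/
def NoFloorTailsDeep : Prop :=
  ∀ p : ℕ, p.Prime → ∀ e : ℕ, 2 ≤ e → ∀ (K : Type) [Field K] [CharP K p] [PerfectField K] [DecidableEq K]
    (s₀ : State (Fin 3) K), IsRoot (p ^ e) s₀ → ∀ W : ForcedWalk (p ^ e) s₀, (∀ i, 1 ≤ (W.st i).shade) →
    ∀ N : ℕ, (∀ t, N ≤ t → ordZero (W.st t).F = ((p ^ e : ℕ) : ℕ∞)) → False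

/-! ## §5 LAWS OF THE HIGH REGIME (PROVED) -/

section High

variable {K : Type} [Field K] [DecidableEq K] {q : ℕ} {s₀ : State (Fin 3) K}

/-- **TRANSLATED STEPS LAND LIGHT (PROVED).**  After a translated move (`b_t ≠ 0`) the new boundary misses a
component other than the chart (the translated direction is lost) and has total mass `< q`: it consists of at most
the chart component and one kept component, a PAIR, bounded by isolation (`pair_lt_of_isolatedTop`). [folklore] -/
theorem translated_step_light (hroot : IsRoot q s₀) (W : ForcedWalk q s₀) (t : ℕ) (hb : W.b t ≠ 0) :
    (∃ k, k ≠ W.j t ∧ (W.st (t + 1)).r k = 0) ∧ (W.st (t + 1)).r.degree < q := by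
  classical
  obtain ⟨o, ho, -⟩ := walk_nat hroot W t
  obtain ⟨k, hk⟩ := Function.ne_iff.mp hb
  have hkj : k ≠ W.j t := by
    intro h
    rw [h, W.onExc t] at hk
    exact hk rfl
  have hk0 : (W.st (t + 1)).r k = 0 := by
    rw [r_succ_eq W t ho, Finsupp.add_apply, kept_apply, if_neg (fun h => hk h.2), Finsupp.single_eq_of_ne hkj,
      add_zero]
  refine ⟨⟨k, hkj, hk0⟩, ?_⟩
  have hz : (W.st (t + 1)).r 0 = 0 ∨ (W.st (t + 1)).r 1 = 0 ∨ (W.st (t + 1)).r 2 = 0 := by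
    revert hk0
    fin_cases k
    · exact fun h => Or.inl h
    · exact fun h => Or.inr (Or.inl h)
    · exact fun h => Or.inr (Or.inr h)
  have h01 := pair_lt_of_isolatedTop (W.isolated (t + 1)) (0 : Fin 3) 1 (by decide)
    (X_pow_mul_X_pow_dvd_of_forall_le (walk_r hroot W (t + 1)) (by decide))
  have h02 := pair_lt_of_isolatedTop (W.isolated (t + 1)) (0 : Fin 3) 2 (by decide)
    (X_pow_mul_X_pow_dvd_of_forall_le (walk_r hroot W (t + 1)) (by decide))
  have h12 := pair_lt_of_isolatedTop (W.isolated (t + 1)) (1 : Fin 3) 2 (by decide)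
    (X_pow_mul_X_pow_dvd_of_forall_le (walk_r hroot W (t + 1)) (by decide))
  rw [Finsupp.degree_eq_sum, Fin.sum_univ_three]
  omega

/-- **On a plateau a translated step bounds the NEXT ORDER: `o_{t+1} ≤ s + q − 1` (PROVED).** [folklore] -/
theorem order_succ_le_of_translated (hroot : IsRoot q s₀) (W : ForcedWalk q s₀) {t s o' : ℕ} (hb : W.b t ≠ 0)
    (hs1 : (W.st (t + 1)).shade = (s : ℕ∞)) (ho' : ordZero (W.st (t + 1)).F = o') : o' + 1 ≤ s + q := by
  have h := order_eq_of_plateau hroot W ho' hs1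
  have hlt := (translated_step_light hroot W t hb).2
  omega

/-- **HEIGHT ONE IS DECIDED (PROVED).**  A plateau of height `s = 1` strictly above the order floor admits no
translated move: after it `o_{t+1} ≤ 1 + (q − 1) = q`. [folklore] -/
theorem noHighPlateaux_shade_one {p e : ℕ} [CharP K p] {s₀ : State (Fin 3) K} (hroot : IsRoot (p ^ e) s₀)
    (W : ForcedWalk (p ^ e) s₀) {N : ℕ}
    (hhi : ∀ t, N ≤ t → (W.st t).shade = ((1 : ℕ) : ℕ∞) ∧ ((p ^ e : ℕ) : ℕ∞) < ordZero (W.st t).F)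
    (htr : ∀ M : ℕ, ∃ i, M ≤ i ∧ W.b i ≠ 0) : False := by
  obtain ⟨t, ht, hb⟩ := htr N
  obtain ⟨o', ho', -⟩ := walk_nat hroot W (t + 1)
  have hle := order_succ_le_of_translated hroot W hb (hhi (t + 1) (by omega)).1 ho'
  have hgt := (hhi (t + 1) (by omega)).2
  rw [ho'] at hgt
  have hgt' : p ^ e < o' := by exact_mod_cast hgt
  omega

/-- **The residual lives at heights `2 ≤ s ≤ q − 1` (PROVED, EXACT).** [folklore] -/
theorem high_iff_highTwo : NoHighPlateauxDeep ↔ NoHighPlateauxDeepTwo := by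
  refine ⟨fun h p hp e he K _ _ _ _ s₀ hs W N s h2 hsq hhi htr => h p hp e he K s₀ hs W N s (by omega) hsq hhi htr,
    fun h p hp e he K _ _ _ _ s₀ hs W N s h1 hsq hhi htr => ?_⟩
  rcases Nat.lt_or_ge s 2 with hs1 | hs2
  · have hs : s = 1 := by omega
    subst hs
    exact noHighPlateaux_shade_one hs W hhi htr
  · exact h p hp e he K s₀ hs W N s hs2 hsq hhi htr

end High

/-- **`NoHighPlateauxDeepOne` — the HEIGHT-ONE SLICE of the high half, a NAMED CLASS (NEW · DECIDED — PROVED: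
`noHighPlateauxDeepOne_holds`).**  No infinite forced deep walk sits, from some time on, on a plateau of height
`s = 1` strictly above the order floor and makes translated moves at infinitely many times: after a translated move the
boundary is a pair of mass `≤ q − 1`, so `o_{t+1} = 1 + m_{t+1} ≤ q`.  [DECIDED · WEAKER than the parent
(`highOne_of_high ∘ high_of_recSubcritical`)]  (Sources: Hauser2010 §G; this file §5.) -/
def NoHighPlateauxDeepOne : Prop :=
  ∀ p : ℕ, p.Prime → ∀ e : ℕ, 2 ≤ e → ∀ (K : Type) [Field K] [CharP K p] [PerfectField K] [DecidableEq K]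
    (s₀ : State (Fin 3) K), IsRoot (p ^ e) s₀ → ∀ W : ForcedWalk (p ^ e) s₀,
    ∀ N : ℕ, (∀ t, N ≤ t → (W.st t).shade = ((1 : ℕ) : ℕ∞) ∧ ((p ^ e : ℕ) : ℕ∞) < ordZero (W.st t).F) →
    (∀ M : ℕ, ∃ i, M ≤ i ∧ W.b i ≠ 0) → False

/-- **The height-one slice HOLDS (PROVED).** [folklore] -/
theorem noHighPlateauxDeepOne_holds : NoHighPlateauxDeepOne :=
  fun _ _ _ _ _ _ _ _ _ _ hs W _ hhi htr => noHighPlateaux_shade_one hs W hhi htr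

/-- The height-one slice is WEAKER than the high half (by letter, `s := 1`). [folklore] -/
theorem highOne_of_high (h : NoHighPlateauxDeep) : NoHighPlateauxDeepOne :=
  fun p hp e he K _ _ _ _ s₀ hs W N hhi htr =>
    h p hp e he K s₀ hs W N 1 le_rfl (Nat.one_lt_pow (by omega) hp.one_lt) hhi htr

/-- **EXACT: the high half = its height-one slice (DECIDED) ∧ the heights `≥ 2` (THE residual).** [folklore] -/
theorem high_iff_one_two : NoHighPlateauxDeep ↔ NoHighPlateauxDeepOne ∧ NoHighPlateauxDeepTwo :=
  ⟨fun h => ⟨highOne_of_high h, high_iff_highTwo.mp h⟩, fun h => high_iff_highTwo.mpr h.2⟩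

section HighWindows

variable {K : Type} [Field K] [DecidableEq K] {q : ℕ} {s₀ : State (Fin 3) K}

/-- **WINDOW OF THE HIGH REGIME (PROVED): `q < o_t < 2q`** (light landing). [folklore] -/
theorem high_window (hroot : IsRoot q s₀) (W : ForcedWalk q s₀) (t : ℕ) (hhi : ((q : ℕ) : ℕ∞) < ordZero (W.st t).F) :
    ∃ o : ℕ, ordZero (W.st t).F = o ∧ q < o ∧ o < 2 * q := by
  -- [WRITER NOTE: the light landing `o_t < 2q` (= the tree's `NoJump.order_lt_two_mul`, a cone module) inlined]
  classical
  obtain ⟨o, ho, hqo⟩ := walk_nat hroot W t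
  obtain ⟨k, hk⟩ := exists_ne (W.j t)
  have hrj : (W.st (t + 1)).r (W.j t) = o - q := by
    rw [r_succ_eq W t ho, Finsupp.add_apply, kept_apply, if_neg (fun h => h.1 rfl), Finsupp.single_eq_same,
      zero_add]
  have hlt := pair_lt_of_isolatedTop (W.isolated (t + 1)) (W.j t) k hk.symm
    (X_pow_mul_X_pow_dvd_of_forall_le (walk_r hroot W (t + 1)) hk.symm)
  rw [hrj] at hlt
  refine ⟨o, ho, ?_, by omega⟩
  rw [ho] at hhi
  exact_mod_cast hhi

/-- **MASS WINDOW OF THE HIGH REGIME (PROVED): `q + 1 ≤ s + m_t ≤ 2q − 1`** on a high plateau of height `s`.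
[folklore] -/
theorem high_mass_window (hroot : IsRoot q s₀) (W : ForcedWalk q s₀) {t s : ℕ} (hs : (W.st t).shade = (s : ℕ∞))
    (hhi : ((q : ℕ) : ℕ∞) < ordZero (W.st t).F) :
    q + 1 ≤ s + (W.st t).r.degree ∧ s + (W.st t).r.degree + 1 ≤ 2 * q := by
  obtain ⟨o, ho, h1, h2⟩ := high_window hroot W t hhi
  have h := order_eq_of_plateau hroot W ho hs
  omega

/-- **FREE STEPS IN THE HIGH REGIME NEED MASS `≥ 2q − 2s + 1` (PROVED).**  A free move (`¬ Satellite`) keeps nothing: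
`m_{t+1} = o_t − q = s + m_t − q`, and staying high at `t + 1` needs `s + m_{t+1} ≥ q + 1`. [folklore] -/
theorem high_free_step (hroot : IsRoot q s₀) (W : ForcedWalk q s₀) {t s : ℕ} (hfree : ¬ W.Satellite t)
    (hs0 : (W.st t).shade = (s : ℕ∞)) (hs1 : (W.st (t + 1)).shade = (s : ℕ∞))
    (hhi1 : ((q : ℕ) : ℕ∞) < ordZero (W.st (t + 1)).F) : 2 * q + 1 ≤ 2 * s + (W.st t).r.degree := by
  classical
  obtain ⟨o, ho, hqo⟩ := walk_nat hroot W t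
  have hm := order_eq_of_plateau hroot W ho hs0
  have hk : kept W t = 0 := by
    by_contra h
    exact hfree ((satellite_iff_kept_ne_zero W t).mpr h)
  have hdeg : (W.st (t + 1)).r.degree = (kept W t).degree + (o - q) := degree_r_succ W t ho
  rw [hk, map_zero, zero_add] at hdeg
  have hw := (high_mass_window hroot W hs1 hhi1).1
  omega

end HighWindows

end Summit.ResolutionOfSingularities.ResolutionOfSingularities.Theorems.FloorCut
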